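/-
Origin: expansion seat `planner-pub-hodgecm-mc-axioms-1-g14-0`, handover #W153 2026-08-20T15:53:55Z md5 2019c6d65283 (PKG 31bcb84ff866 → 2019c6d65283; 216 l.; MECHANICAL (iib-R) rewrite v3.1 of the PKG file as it stands (53 token edits; rules R1x1+R2x2+RX[h₂']x26+R3x5+R8x19)) (`HOME/mc/pub-hodgecm-mc-axioms-1-g14/revendor/kit-r55/stage55/HodgeCM/Model/LevelTransferPush.lean`, md5 2019c6d65283, 216 lines);
landed by the gen-22 packager (p-g22) in gate run 55 REPLACES the earlier landed copy of `HodgeCM/Model/LevelTransferPush.lean` (seat copy carried the packager Origin header of an earlier run (stripped)).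
-/
/-
Origin: CONSTRUCTION seat `planner-pub-hodgecm-mc-axioms-1-g7-0` (unit pub-hodgecm-mc-axioms-1-g7, gen 7 of lineage
mc-axioms-1; MODEL-DAG node N-i1, ruling (L-lvl); desk booking model2-g5 (RRR′) 2026-08-19T07:08:33Z: "N-i1 instance `D`
PUSH HALF"). NEW additive leaf `HodgeCM/Model/LevelTransferPush.lean` over the installed `HodgeCM/Model/CoverInstance.lean`
(gate run 33) and two NEW vendored twins of tree files (`Vendored/H21/AlgebraicGeometry/ShimuraVarieties/
UnitaryBallLevelFiniteCover.lean`, hub proposal p184652; `Vendored/H21/AlgebraicGeometry/Motives/AlgPointsNonempty.lean`,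
accepted tree file). Expected `#print axioms`: {propext, Classical.choice, Quot.sound}.
-/
import Summits.HodgeConjecture.HodgeCM.Model.CoverInstance
import Literature.AlgebraicGeometry.ShimuraVarieties.UnitaryBallLevelFiniteCover
import Literature.AlgebraicGeometry.Motives.AlgPointsNonempty

/-!
# The push-forward half of the level transfer datum `D` (MODEL-DAG N-i1), CONSTRUCTED

For the Picard–CM model universe `U := picardCMUniverse hHD hI h₁ hU h₃`, two levels `Γ₁ ≤ Γ` of one hermitian
space `V`, and the level covering `p := coverOf … hA Γ Γ₁ hle : U.Mor (U.pms L ι₁ V Γ₁) (U.pms L ι₁ V Γ)`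
(`HodgeCM/Model/CoverInstance.lean`), this file builds — as KERNEL terms over the same record binders as
`coverOf` and nothing else — the first four fields of the record
`Universe.LevelTransfer U p` of `HodgeCM/Model/LevelDescent.lean` (gen 6, staged kit t35 row #1):

* `isFiniteCover_coverOf` — the continuous map `p(ℂ) : X_{Γ₁}(ℂ) → X_Γ(ℂ)` is a finite covering
  (`IsFiniteCover`): in the anisotropic regime both schemes carry ball-quotient data with THE SAME complex
  hermitian matrix (`ballDatum_Hℂ_eq`) and `p(ℂ)` intertwines the two uniformisations (`map_coverOf_unif`),
  so the tree theorem `UnitaryBallUniformisationDatum.isFiniteCover_of_unif_comp` (vendored twin of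
  `Literature/AlgebraicGeometry/ShimuraVarieties/UnitaryBallLevelFiniteCover.lean`: a map intertwining the
  uniformisations of two torsion-free ball quotients is a local homeomorphism between compact Hausdorff spaces,
  hence a finite covering) applies; off that regime `p` is the identity `eqToHom` of `ℙ²`, a one-sheeted
  covering;
* `degOf` — its number of sheets `deg` (least fibre cardinality, Hatcher 2002 §1.3 p. 56), `degOf_pos : 0 < deg`
  (`X_Γ(ℂ)` is non-empty: the image of the ball, resp. `ℙ²(ℂ) ≠ ∅`);
* `pushOf` — the push-forward `push := deg • τ : H¹(X_{Γ₁}, ℚ) →ₗ[ℚ] H¹(X_Γ, ℚ)`, where `τ` is the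
  normalised transfer of a finite covering (`IsFiniteCover.transferMap`, vendored twin of
  `Literature/AlgebraicTopology/SingularHomology/FiniteCoverTransfer.lean`, Hatcher 2002 §3.G Prop. 3G.1 with
  the `1/d_b`-normalisation), and
* `pushOf_comp_pull` — the projection formula `push ∘ₗ p^* = deg • id` (`IsFiniteCover.transferMap_map`:
  `τ ∘ p^* = id`).

The two remaining fields (`norm`, `push_pull_norm`: the norm of a morphism to a CM abelian variety and its
compatibility with `push`) are NOT constructed here; `HodgeCM/Model/LevelTransferOf.lean` assembles the record
from these four terms and those two as explicit binders.

References: N. Bergeron, J. Millson, C. Moeglin, *The Hodge conjecture and arithmetic quotients of complex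
balls*, Acta Math. 216 (2016), Introduction §1.1, Part 2 §1.3 (neat level structures give genuine manifolds
and finite level coverings); A. Hatcher, *Algebraic Topology* (2002), §1.3 p. 56 (number of sheets), §3.G
Prop. 3G.1 p. 321 (transfer: `τ ∘ p^* = d`).
-/

noncomputable section

open scoped Matrix ComplexOrder
open NumberField CategoryTheory
open Literature.AlgebraicGeometry.Motives
open Literature.AlgebraicGeometry.ShimuraVarieties
open Literature.AlgebraicTopology.SingularHomology
open Literature.NumberTheory.Transcendental (Arapura2012_Cor_15_4_6)

namespace HodgeCM

namespace Model

open Literature.NumberTheory.Automorphic.PicardCM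
open Literature.AlgebraicGeometry.HodgeTheory

/-! ### Generalities: identity coverings, compactness of the points of the universe -/

section General

universe u

/-- The identity of a compact Hausdorff space is a finite covering (one sheet). -/
theorem isFiniteCover_id (E : Type u) [TopologicalSpace E] [T2Space E] [CompactSpace E] :
    IsFiniteCover (ContinuousMap.id E) where
  isCoveringMap := isLocalHomeomorph_iff_isCoveringMap.1 (Homeomorph.refl E).isLocalHomeomorph
  surjective := Function.surjective_id
  finite_fibre b := by simp

/-- The map on complex points of an identity `eqToHom` between schemes is a finite covering. -/
theorem isFiniteCover_mapContinuous_eqToHom {X Y : SchemeOver ℂ} [T2Space (ComplexPoints X)]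
    [CompactSpace (ComplexPoints X)] (e : X = Y) :
    IsFiniteCover (AlgPoints.mapContinuous (L := ℂ) (eqToHom e)) := by
  subst e
  rw [eqToHom_refl, AlgPoints.mapContinuous_id]
  exact isFiniteCover_id _

variable (hU : BallQuotientUniformisedDatum) (h₃ : CMAbelianVarietyRealised)

/-- The complex points of every variety of the universe form a compact space (smooth projective ⇒ proper ⇒
`X(ℂ)` compact). -/
theorem compactSpace_complexPoints_scheme (X : Var) : CompactSpace (ComplexPoints (Var.scheme hU h₃ X)) := by
  haveI := IsSmoothProjective.isProper_holds (Var.isSmoothProjective hU h₃ X)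
  exact compactSpace_algPoints_of_isProper_holds _ ℂ

/-- … and a Hausdorff space (proper ⇒ separated ⇒ `X(ℂ)` Hausdorff). -/
theorem t2Space_complexPoints_scheme (X : Var) : T2Space (ComplexPoints (Var.scheme hU h₃ X)) := by
  haveI := IsSmoothProjective.isProper_holds (Var.isSmoothProjective hU h₃ X)
  exact ComplexPoints.t2Space_of_isSeparated _

variable {L : CMField} {ι₁ : L →+* ℂ} {V : HermSpace3 L ι₁}

/-- The complex points of a Picard modular surface of the universe are non-empty: the image of the ball in
the anisotropic regime, `ℙ²(ℂ)` off it. -/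
theorem nonempty_complexPoints_pms (Γ : Level V) :
    Nonempty (ComplexPoints (Var.scheme hU h₃ (.pms (pmsCode L ι₁ V Γ)))) := by
  by_cases h : (pmsCode L ι₁ V Γ).IsAnisotropic
  · exact (Var.ballDatum hU h₃ (pmsCode L ι₁ V Γ) h).nonempty_complexPoints
  · rw [scheme_pms_of_not_isAnisotropic hU h₃ _ h]
    infer_instance

end General

/-! ### The level covering is a finite covering -/

section Data

variable (hU : BallQuotientUniformisedDatum) (h₃ : CMAbelianVarietyRealised)
variable {L : CMField} {ι₁ : L →+* ℂ} {V : HermSpace3 L ι₁}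

/-- Off the anisotropic regime the level covering is an identity `eqToHom` (by definition). -/
theorem levelCover_eq_eqToHom_of_not_isAnisotropic (hHD : exists_isReal_hodgeModel)
    (hA : Arapura2012_Cor_15_4_6) (Γ Γ' : Level V) (hle : Γ'.Γ ≤ Γ.Γ) (h : ¬ IsAnisotropic L V.Hm) :
    ∃ e : Var.scheme hU h₃ (.pms (pmsCode L ι₁ V Γ')) = Var.scheme hU h₃ (.pms (pmsCode L ι₁ V Γ)),
      levelCover hU h₃ hHD hA Γ Γ' hle = eqToHom e := by
  unfold levelCover
  rw [dif_neg h]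
  exact ⟨_, rfl⟩

/-- **The level covering `X_{Γ'}(ℂ) → X_Γ(ℂ)` is a finite covering.** Anisotropic regime: the two ball data
have the same complex hermitian matrix (`ballDatum_Hℂ_eq`) and `levelCover` intertwines their uniformisations
(`map_levelCover_unif`), so `UnitaryBallUniformisationDatum.isFiniteCover_of_unif_comp` applies. Off it: the identity
of `ℙ²(ℂ)`. -/
theorem isFiniteCover_levelCover (hHD : exists_isReal_hodgeModel) (hA : Arapura2012_Cor_15_4_6)
    (Γ Γ' : Level V) (hle : Γ'.Γ ≤ Γ.Γ) :
    IsFiniteCover (AlgPoints.mapContinuous (L := ℂ) (levelCover hU h₃ hHD hA Γ Γ' hle)) := by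
  by_cases h : IsAnisotropic L V.Hm
  · exact UnitaryBallUniformisationDatum.isFiniteCover_of_unif_comp
      (ballDatum_Hℂ_eq hU h₃ Γ Γ' ((isAnisotropic_pmsCode_iff L ι₁ V Γ').2 h)
        ((isAnisotropic_pmsCode_iff L ι₁ V Γ).2 h))
      _ (fun v hv ↦ map_levelCover_unif hU h₃ hHD hA hle h hv)
  · haveI := compactSpace_complexPoints_scheme hU h₃ (.pms (pmsCode L ι₁ V Γ'))
    haveI := t2Space_complexPoints_scheme hU h₃ (.pms (pmsCode L ι₁ V Γ'))
    obtain ⟨e, he⟩ := levelCover_eq_eqToHom_of_not_isAnisotropic hU h₃ hHD hA Γ Γ' hle h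
    rw [he]
    exact isFiniteCover_mapContinuous_eqToHom e

end Data

/-! ### On the end-state universe `picardCMUniverse`: `deg`, `push`, `push ∘ p^* = deg • id` -/

section EndState

variable (hHD : exists_isReal_hodgeModel) (hI : hodgePQ_independent_of_hodgeModel)
  (h₁ : BallQuotientUniformised)  (h₃ : CMAbelianVarietyRealised)

/-- **`coverOf … Γ Γ₁ hle` is a finite covering on complex points.** -/
theorem isFiniteCover_coverOf (hA : Arapura2012_Cor_15_4_6) {L : CMField} {ι₁ : L →+* ℂ}
    {V : HermSpace3 L ι₁} (Γ Γ₁ : Level V) (hle : Γ₁.Γ ≤ Γ.Γ) :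
    IsFiniteCover (AlgPoints.mapContinuous (L := ℂ) (coverOf hHD hI h₁ h₃ hA Γ Γ₁ hle)) :=
  isFiniteCover_levelCover _ _ hHD hA Γ Γ₁ hle

/-- **`deg`**: the number of sheets of the level covering `X_{Γ₁} → X_Γ`. -/
def degOf (hA : Arapura2012_Cor_15_4_6) {L : CMField} {ι₁ : L →+* ℂ} {V : HermSpace3 L ι₁}
    (Γ Γ₁ : Level V) (hle : Γ₁.Γ ≤ Γ.Γ) : ℕ :=
  (isFiniteCover_coverOf hHD hI h₁ h₃ hA Γ Γ₁ hle).sheets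

/-- **`deg_pos`**: the level covering has a positive number of sheets (`X_Γ(ℂ) ≠ ∅`). -/
theorem degOf_pos (hA : Arapura2012_Cor_15_4_6) {L : CMField} {ι₁ : L →+* ℂ} {V : HermSpace3 L ι₁}
    (Γ Γ₁ : Level V) (hle : Γ₁.Γ ≤ Γ.Γ) : 0 < degOf hHD hI h₁ h₃ hA Γ Γ₁ hle := by
  haveI : Nonempty (ComplexPoints (Var.scheme (ballQuotientUniformisedDatum_of h₁) h₃
      ((picardCMUniverse hHD hI h₁ h₃).pms L ι₁ V Γ))) :=
    nonempty_complexPoints_pms (ballQuotientUniformisedDatum_of h₁) h₃ Γ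
  exact (isFiniteCover_coverOf hHD hI h₁ h₃ hA Γ Γ₁ hle).sheets_pos

/-- **`push`**: the push-forward `H¹(X_{Γ₁}, ℚ) →ₗ[ℚ] H¹(X_Γ, ℚ)` along the level covering — `deg` times the
normalised transfer of the finite covering `coverOf … (ℂ)`. -/
def pushOf (hA : Arapura2012_Cor_15_4_6) {L : CMField} {ι₁ : L →+* ℂ} {V : HermSpace3 L ι₁}
    (Γ Γ₁ : Level V) (hle : Γ₁.Γ ≤ Γ.Γ) :
    (picardCMUniverse hHD hI h₁ h₃).Coh ((picardCMUniverse hHD hI h₁ h₃).pms L ι₁ V Γ₁) 1 →ₗ[ℚ]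
      (picardCMUniverse hHD hI h₁ h₃).Coh ((picardCMUniverse hHD hI h₁ h₃).pms L ι₁ V Γ) 1 :=
  (degOf hHD hI h₁ h₃ hA Γ Γ₁ hle : ℚ) •
    ((isFiniteCover_coverOf hHD hI h₁ h₃ hA Γ Γ₁ hle).transferMap (R := ℚ) 1).hom

/-- The normalised transfer is a retraction of `p^*` on `H¹` (pointwise). -/
theorem transferMap_pull_apply (hA : Arapura2012_Cor_15_4_6) {L : CMField} {ι₁ : L →+* ℂ}
    {V : HermSpace3 L ι₁} (Γ Γ₁ : Level V) (hle : Γ₁.Γ ≤ Γ.Γ)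
    (x : (picardCMUniverse hHD hI h₁ h₃).Coh ((picardCMUniverse hHD hI h₁ h₃).pms L ι₁ V Γ) 1) :
    ((isFiniteCover_coverOf hHD hI h₁ h₃ hA Γ Γ₁ hle).transferMap (R := ℚ) 1).hom
        ((picardCMUniverse hHD hI h₁ h₃).pull (coverOf hHD hI h₁ h₃ hA Γ Γ₁ hle) 1 x) = x :=
  (isFiniteCover_coverOf hHD hI h₁ h₃ hA Γ Γ₁ hle).transferMap_map 1 x

/-- **`push_pull`** — the projection formula: `push ∘ₗ p^* = deg • id` on `H¹(X_Γ, ℚ)`. -/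
theorem pushOf_comp_pull (hA : Arapura2012_Cor_15_4_6) {L : CMField} {ι₁ : L →+* ℂ}
    {V : HermSpace3 L ι₁} (Γ Γ₁ : Level V) (hle : Γ₁.Γ ≤ Γ.Γ) :
    pushOf hHD hI h₁ h₃ hA Γ Γ₁ hle ∘ₗ
        (picardCMUniverse hHD hI h₁ h₃).pull (coverOf hHD hI h₁ h₃ hA Γ Γ₁ hle) 1 =
      (degOf hHD hI h₁ h₃ hA Γ Γ₁ hle : ℚ) • LinearMap.id := by
  apply LinearMap.ext
  intro x
  change (degOf hHD hI h₁ h₃ hA Γ Γ₁ hle : ℚ) •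
      ((isFiniteCover_coverOf hHD hI h₁ h₃ hA Γ Γ₁ hle).transferMap (R := ℚ) 1).hom
        ((picardCMUniverse hHD hI h₁ h₃).pull (coverOf hHD hI h₁ h₃ hA Γ Γ₁ hle) 1 x) =
    (degOf hHD hI h₁ h₃ hA Γ Γ₁ hle : ℚ) • x
  rw [transferMap_pull_apply]
  rfl

end EndState

end Model

end HodgeCM

end
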